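import Summits.HodgeConjecture.HodgeConjecture.Theorems.F0P3ValueMapTransport
import Summits.HodgeConjecture.HodgeConjecture.Theorems.F0P3bStubT6rPNullRigidity
import HarnessLib

/-!
# FLOOR-0 P3 — rung-1 brick R3: the ARCHIMEDEAN HALF of E1′h — two irreducible `(𝔤, K)`-modules of `U(2,1)` carrying
# non-zero typed-`δ` null VALUE MAPS are `(𝔤, K)`-EQUIVALENT; detected form (F1a currency)

Cell hodgecm-mathlib, FLOOR 0, crux item H413 = stmt-HodgeConjecture-24833, line `Cruxes/H413/Lines/F0_U3CohMultOne.lean` v1.4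
(row III-J3a modulo FIVE letters {E1, E1′h, E2′, (D)h, (E)h}); integrator map `F0/P3/ENGINE-INTERFACES.F0P3g0.md` §7 («E1′h ⇐
T6c (at ι) + F1 + E1») and §7h ∕ §7k ∕ §7l (the VALUE-MAP road: S0 ★ `F0P3ArchValueMapRigidity`, S2 ★ `F0P3ValueMapTransport`);
PROOF lane (no `def`, no named fact, no `sorry`); author F0P3-p04 (g3).  This file is the third irreducible-module theorem of the
value-map road, next to S0's R1 (E2′₀-arch: not both types) and R2 ((E)h-arch: one complex line):

* §1 (R3, E1′h-arch, `U(2,1)`, hypotheses `hV`∕`hV′` + `IsIrreducibleGK` ×2 ONLY — no unitarity, no admissibility)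
  `areGKEquivalent_of_valueMaps`: two IRREDUCIBLE pair data `(ρK, ρ𝔤)` on `V` and `(ρK′, ρ𝔤′)` on `V′` each carrying a NON-ZERO
  typed-`δ` null value map (`δ ∈ {±1}`; the five explicit conditions h0∕hK∕h𝔨∕hwt∕hN of S0, no new definition) are
  `(𝔤, K)`-equivalent (`AreGKEquivalent`).  Proof: package both value maps as non-zero type-`δ` `𝔭^{−δ}`-null `(𝔤, K)`-1-cochains
  (★ S0 `exists_typedCochain_of_valueMap`); by ★ T6k (1) (`F0P3bStubT6kU21PGeometry.stubT6k_holds`, F0P3-p04 (g2)) the kernel of a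
  non-zero type-`δ` cochain of `U(2,1)` is EXACTLY `𝔨`, so the two kernels agree; ★ T6r (`F0P3bStubT6rPNullRigidity.stubT6r_holds`,
  F0P3-p03 (g2): rigidity from the generating datum) then gives the equivalence.  This is the unitarity-free form of the engine's T6c
  (`StubT6cDegOneTypeRigid` needs `IsCohUnitaryIrrep` on both sides), in the currency the junction B1′ (`F0P3CotangentFormValueMap`,
  F0P3-p01 (g3)) hands over.
* §2 (detected form, the shape F1a ★∕p797762 `DiscreteAutomorphicRep.ArchIsotypy` delivers) `areGKEquivalent_of_detected`: if the
  non-zero vectors of `V` are detected by equivariant maps into an irreducible `M` and those of `V′` by maps into an irreducible `M′`,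
  then non-zero typed-`δ` null value maps on `V` and on `V′` force `M ≃ M′` (`AreGKEquivalent`) — NO hypothesis on `V`, `V′`
  themselves (★ S2 `exists_valueMap_irreducible_of_detected` ×2 + §1); and `exists_ne_zero_map_of_valueMap`: a non-zero value map
  on a detected `V` yields a NON-ZERO equivariant `V → M` (the datum (i) of the tensor-rigidity letter F1b′).

USE (rung 1, letter E1′h `Rogawski1990.cohFinComponentUnique_hol`): for discrete `P`, `P′` of hol type at `ι`, B1′ gives non-zero
typed-`(+1)` null value maps on `P.archModule`, `P′.archModule`; F1a detects them in irreducible admissible `M`, `M′`; §2 gives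
`M ≃ M′` — the archimedean components of `P`, `P′` at `ι` agree at the `(𝔤, K)`-level.  With `K_c`-sphericity (the hol cotangent
forms are right-`K_c`-invariant, `K_c = cmCompactFactor`) and the common finite component `σ`, the tensor-rigidity letter makes
`P ≅ P′` unitarily, and E1 (multiplicity `≤ 1`, ★ `hasMultiplicityOne_iff_multiplicity_le_one_holds`) forces `P = P′`.

References: A. Borel, N. Wallach, *Continuous cohomology, discrete subgroups, and representations of reductive groups*, 2nd ed.,
AMS 2000, I §5.1, II §4.1–4.2, VI Thm. 4.11 [BorelWallach2000]; J. Rogawski, *Automorphic representations of unitary groups in three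
variables*, Ann. of Math. Stud. 123 (1990), §12.3 p. 178, Prop. 15.2.1 (b), §15.3 ¶1 [Rogawski1990]; D. Vogan, G. Zuckerman,
*Unitary representations with non-zero cohomology*, Compositio Math. 53 (1984), Thm. 5.6 [VoganZuckerman1984]; D. Flath,
*Decomposition of representations into tensor products*, PSPM 33.1 (1979), Thm. 3 [Flath1979].
HONEST LABEL: HC_CM is proved only modulo the printed citations until rung 0 closes; this file discharges none of them.
-/

-- Mathlib idiom (as in `GKModules`, `GKCohomology`, the `Upq*` files, S0 and S2): commutator bracket on `Module.End`
attribute [local instance 100] LieRing.ofAssociativeRing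

set_option autoImplicit false
set_option linter.dupNamespace false

noncomputable section

namespace Summit.HodgeConjecture.HodgeConjecture.Cruxes.H413.F0P3ArchValueMapEquivalence

open Literature.Algebra.Lie Literature.Algebra.Lie.ChevalleyEilenberg
open Literature.NumberTheory.Automorphic
open Literature.RepresentationTheory.BorelWallach2000
open Literature.RepresentationTheory.KonnoKonno2007 Literature.RepresentationTheory.KonnoKonno2007.RealDualPair
open Literature.RepresentationTheory.KonnoKonno2007.RealDualPair.UForm
open Summit.HodgeConjecture.HodgeConjecture.Cruxes.H413.F0P3bStubT6kU21PGeometry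
open Summit.HodgeConjecture.HodgeConjecture.Cruxes.H413.F0P3bStubT6rPNullRigidity
open Summit.HodgeConjecture.HodgeConjecture.Cruxes.H413.F0P3ArchValueMapRigidity
open Summit.HodgeConjecture.HodgeConjecture.Cruxes.H413.F0P3ValueMapTransport

/-! ## §1 (R3) E1′h at the archimedean place, `U(2,1)`: irreducible modules with typed-`δ` null value maps are equivalent -/

section Irreducible

variable {V : Type} [AddCommGroup V] [Module ℂ V]
  (ρK : Representation ℂ (uFormGroup (Fin 2) (Fin 1)).maximalCompact V)
  (ρ𝔤 : (uFormGroup (Fin 2) (Fin 1)).lie →ₗ⁅ℝ⁆ Module.End ℂ V)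
  (hV : ∀ (k : (uFormGroup (Fin 2) (Fin 1)).maximalCompact) (X : (uFormGroup (Fin 2) (Fin 1)).lie),
    ρK k ∘ₗ ρ𝔤 X ∘ₗ ρK k⁻¹ =
      ρ𝔤 ((uFormGroup (Fin 2) (Fin 1)).Ad (Subgroup.inclusion (uFormGroup (Fin 2) (Fin 1)).maximalCompact_le_carrier k) X))
  {V' : Type} [AddCommGroup V'] [Module ℂ V']
  (ρK' : Representation ℂ (uFormGroup (Fin 2) (Fin 1)).maximalCompact V')
  (ρ𝔤' : (uFormGroup (Fin 2) (Fin 1)).lie →ₗ⁅ℝ⁆ Module.End ℂ V')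
  (hV' : ∀ (k : (uFormGroup (Fin 2) (Fin 1)).maximalCompact) (X : (uFormGroup (Fin 2) (Fin 1)).lie),
    ρK' k ∘ₗ ρ𝔤' X ∘ₗ ρK' k⁻¹ =
      ρ𝔤' ((uFormGroup (Fin 2) (Fin 1)).Ad (Subgroup.inclusion (uFormGroup (Fin 2) (Fin 1)).maximalCompact_le_carrier k) X))

include hV hV' in
/-- **E1′h-arch (R3), `U(2,1)`: two IRREDUCIBLE `(𝔤, K)`-modules each carrying a non-zero typed-`δ` null value map
(`δ ∈ {±1}`) are `(𝔤, K)`-equivalent.**  Both value maps ARE non-zero type-`δ` `𝔭^{−δ}`-null `(𝔤, K)`-1-cochains (★ S0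
`exists_typedCochain_of_valueMap`); the kernel of a non-zero type-`δ` cochain of `U(2,1)` is `𝔨` (★ T6k (1)), so the kernels
agree, and rigidity from the generating datum (★ T6r) gives the equivalence.  No unitarity ∕ admissibility (the engine's T6c
`StubT6cDegOneTypeRigid` is the `IsCohUnitaryIrrep` form of the same statement).
[cite: BorelWallach2000, VI Thm. 4.11 (1); II §4.1–4.2] [cite: Rogawski1990, Prop. 15.2.1 (b); §12.3 p. 178]
[cite: VoganZuckerman1984, Thm. 5.6] -/
theorem areGKEquivalent_of_valueMaps (hirr : IsIrreducibleGK ρK ρ𝔤) (hirr' : IsIrreducibleGK ρK' ρ𝔤')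
    {δ : ℤ} (hδ : δ = 1 ∨ δ = -1)
    (φ : (uFormGroup (Fin 2) (Fin 1)).lie →ₗ[ℝ] V) (φ' : (uFormGroup (Fin 2) (Fin 1)).lie →ₗ[ℝ] V')
    (h0 : ∀ W ∈ (uFormGroup (Fin 2) (Fin 1)).kInLie, φ W = 0)
    (hK : ∀ (k : (uFormGroup (Fin 2) (Fin 1)).maximalCompact) (X : (uFormGroup (Fin 2) (Fin 1)).lie),
      ρK k (φ X) = φ ((uFormGroup (Fin 2) (Fin 1)).Ad (Subgroup.inclusion (uFormGroup (Fin 2) (Fin 1)).maximalCompact_le_carrier k) X))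
    (h𝔨 : ∀ W ∈ (uFormGroup (Fin 2) (Fin 1)).kInLie, ∀ X : (uFormGroup (Fin 2) (Fin 1)).lie, φ ⁅W, X⁆ = ρ𝔤 W (φ X))
    (hwt : ∀ X : (uFormGroup (Fin 2) (Fin 1)).lie, ρ𝔤 (upqZ0 (Fin 2) (Fin 1)) (φ X) = ((δ : ℂ) * Complex.I) • φ X)
    (hN : ∀ (X : (uFormGroup (Fin 2) (Fin 1)).lie) (s : (Fin 2 × Fin 1) × Fin 2),
      ρ𝔤 (upqPBasis s) (φ X) + ((δ : ℂ) * Complex.I) • ρ𝔤 ⁅upqZ0 (Fin 2) (Fin 1), upqPBasis s⁆ (φ X) = 0)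
    (h0' : ∀ W ∈ (uFormGroup (Fin 2) (Fin 1)).kInLie, φ' W = 0)
    (hK' : ∀ (k : (uFormGroup (Fin 2) (Fin 1)).maximalCompact) (X : (uFormGroup (Fin 2) (Fin 1)).lie),
      ρK' k (φ' X) = φ' ((uFormGroup (Fin 2) (Fin 1)).Ad (Subgroup.inclusion (uFormGroup (Fin 2) (Fin 1)).maximalCompact_le_carrier k) X))
    (h𝔨' : ∀ W ∈ (uFormGroup (Fin 2) (Fin 1)).kInLie, ∀ X : (uFormGroup (Fin 2) (Fin 1)).lie, φ' ⁅W, X⁆ = ρ𝔤' W (φ' X))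
    (hwt' : ∀ X : (uFormGroup (Fin 2) (Fin 1)).lie, ρ𝔤' (upqZ0 (Fin 2) (Fin 1)) (φ' X) = ((δ : ℂ) * Complex.I) • φ' X)
    (hN' : ∀ (X : (uFormGroup (Fin 2) (Fin 1)).lie) (s : (Fin 2 × Fin 1) × Fin 2),
      ρ𝔤' (upqPBasis s) (φ' X) + ((δ : ℂ) * Complex.I) • ρ𝔤' ⁅upqZ0 (Fin 2) (Fin 1), upqPBasis s⁆ (φ' X) = 0)
    (hφ : φ ≠ 0) (hφ' : φ' ≠ 0) : AreGKEquivalent ρK ρ𝔤 ρK' ρ𝔤' := by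
  obtain ⟨f, hft, -, hfN, hf0⟩ := exists_typedCochain_of_valueMap ρK ρ𝔤 hV φ h0 hK h𝔨 hwt hN
  obtain ⟨f', hf't, -, hf'N, hf'0⟩ := exists_typedCochain_of_valueMap ρK' ρ𝔤' hV' φ' h0' hK' h𝔨' hwt' hN'
  -- both kernels are exactly `𝔨` (T6k (1)), hence equal
  have hk : ∀ X : (uFormGroup (Fin 2) (Fin 1)).lie, f ![X] = 0 ↔ X ∈ (uFormGroup (Fin 2) (Fin 1)).kInLie :=
    (stubT6k_holds V ρK ρ𝔤 hV δ hδ f f hft hft (hf0 hφ)).1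
  have hk' : ∀ X : (uFormGroup (Fin 2) (Fin 1)).lie, f' ![X] = 0 ↔ X ∈ (uFormGroup (Fin 2) (Fin 1)).kInLie :=
    (stubT6k_holds V' ρK' ρ𝔤' hV' δ hδ f' f' hf't hf't (hf'0 hφ')).1
  exact stubT6r_holds (Fin 2) (Fin 1) V ρK ρ𝔤 hV V' ρK' ρ𝔤' hV' hirr hirr' δ hδ f f' hft hf't (hf0 hφ) (hf'0 hφ') hfN hf'N
    fun X => (hk X).trans (hk' X).symm

end Irreducible

/-! ## §2 Detected form (F1a currency): the irreducible modules detecting two value-map carriers are equivalent -/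

section Detected

variable {V : Type} [AddCommGroup V] [Module ℂ V]
  (ρK : Representation ℂ (uFormGroup (Fin 2) (Fin 1)).maximalCompact V)
  (ρ𝔤 : (uFormGroup (Fin 2) (Fin 1)).lie →ₗ⁅ℝ⁆ Module.End ℂ V)
  {M : Type} [AddCommGroup M] [Module ℂ M]
  (σK : Representation ℂ (uFormGroup (Fin 2) (Fin 1)).maximalCompact M)
  (σ𝔤 : (uFormGroup (Fin 2) (Fin 1)).lie →ₗ⁅ℝ⁆ Module.End ℂ M)
  (hM : ∀ (k : (uFormGroup (Fin 2) (Fin 1)).maximalCompact) (X : (uFormGroup (Fin 2) (Fin 1)).lie),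
    σK k ∘ₗ σ𝔤 X ∘ₗ σK k⁻¹ =
      σ𝔤 ((uFormGroup (Fin 2) (Fin 1)).Ad (Subgroup.inclusion (uFormGroup (Fin 2) (Fin 1)).maximalCompact_le_carrier k) X))
  {V' : Type} [AddCommGroup V'] [Module ℂ V']
  (ρK' : Representation ℂ (uFormGroup (Fin 2) (Fin 1)).maximalCompact V')
  (ρ𝔤' : (uFormGroup (Fin 2) (Fin 1)).lie →ₗ⁅ℝ⁆ Module.End ℂ V')
  {M' : Type} [AddCommGroup M'] [Module ℂ M']
  (σK' : Representation ℂ (uFormGroup (Fin 2) (Fin 1)).maximalCompact M')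
  (σ𝔤' : (uFormGroup (Fin 2) (Fin 1)).lie →ₗ⁅ℝ⁆ Module.End ℂ M')
  (hM' : ∀ (k : (uFormGroup (Fin 2) (Fin 1)).maximalCompact) (X : (uFormGroup (Fin 2) (Fin 1)).lie),
    σK' k ∘ₗ σ𝔤' X ∘ₗ σK' k⁻¹ =
      σ𝔤' ((uFormGroup (Fin 2) (Fin 1)).Ad (Subgroup.inclusion (uFormGroup (Fin 2) (Fin 1)).maximalCompact_le_carrier k) X))

include hM hM' in
/-- **E1′h-arch for DETECTED modules (`U(2,1)`)**: let the non-zero vectors of `V` be detected by equivariant `ℂ`-linear maps into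
an IRREDUCIBLE pair datum `M`, and those of `V′` by maps into an irreducible `M′` (the archimedean isotypy F1a of two discrete
automorphic representations, [Flath1979 Thm 3]).  If `V` and `V′` both carry a NON-ZERO typed-`δ` null value map (`δ ∈ {±1}`), then
`M ≃ M′` as `(𝔤, K)`-modules — no hypothesis on `V`, `V′` themselves (★ S2 `exists_valueMap_irreducible_of_detected` ×2 + §1).
[cite: BorelWallach2000, VI Thm. 4.11 (1)] [cite: Rogawski1990, Prop. 15.2.1 (b), §15.3 ¶1] [cite: Flath1979, Thm. 3] -/
theorem areGKEquivalent_of_detected (hirr : IsIrreducibleGK σK σ𝔤) (hirr' : IsIrreducibleGK σK' σ𝔤')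
    (hdet : ∀ v : V, v ≠ 0 → ∃ T : V →ₗ[ℂ] M,
      (∀ (k : (uFormGroup (Fin 2) (Fin 1)).maximalCompact) (w : V), T (ρK k w) = σK k (T w)) ∧
      (∀ (X : (uFormGroup (Fin 2) (Fin 1)).lie) (w : V), T (ρ𝔤 X w) = σ𝔤 X (T w)) ∧ T v ≠ 0)
    (hdet' : ∀ v : V', v ≠ 0 → ∃ T : V' →ₗ[ℂ] M',
      (∀ (k : (uFormGroup (Fin 2) (Fin 1)).maximalCompact) (w : V'), T (ρK' k w) = σK' k (T w)) ∧
      (∀ (X : (uFormGroup (Fin 2) (Fin 1)).lie) (w : V'), T (ρ𝔤' X w) = σ𝔤' X (T w)) ∧ T v ≠ 0)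
    {δ : ℤ} (hδ : δ = 1 ∨ δ = -1)
    (φ : (uFormGroup (Fin 2) (Fin 1)).lie →ₗ[ℝ] V) (φ' : (uFormGroup (Fin 2) (Fin 1)).lie →ₗ[ℝ] V')
    (hφ : φ ≠ 0) (hφ' : φ' ≠ 0)
    (h0 : ∀ W ∈ (uFormGroup (Fin 2) (Fin 1)).kInLie, φ W = 0)
    (hK : ∀ (k : (uFormGroup (Fin 2) (Fin 1)).maximalCompact) (X : (uFormGroup (Fin 2) (Fin 1)).lie),
      ρK k (φ X) = φ ((uFormGroup (Fin 2) (Fin 1)).Ad (Subgroup.inclusion (uFormGroup (Fin 2) (Fin 1)).maximalCompact_le_carrier k) X))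
    (h𝔨 : ∀ W ∈ (uFormGroup (Fin 2) (Fin 1)).kInLie, ∀ X : (uFormGroup (Fin 2) (Fin 1)).lie, φ ⁅W, X⁆ = ρ𝔤 W (φ X))
    (hwt : ∀ X : (uFormGroup (Fin 2) (Fin 1)).lie, ρ𝔤 (upqZ0 (Fin 2) (Fin 1)) (φ X) = ((δ : ℂ) * Complex.I) • φ X)
    (hN : ∀ (X : (uFormGroup (Fin 2) (Fin 1)).lie) (s : (Fin 2 × Fin 1) × Fin 2),
      ρ𝔤 (upqPBasis s) (φ X) + ((δ : ℂ) * Complex.I) • ρ𝔤 ⁅upqZ0 (Fin 2) (Fin 1), upqPBasis s⁆ (φ X) = 0)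
    (h0' : ∀ W ∈ (uFormGroup (Fin 2) (Fin 1)).kInLie, φ' W = 0)
    (hK' : ∀ (k : (uFormGroup (Fin 2) (Fin 1)).maximalCompact) (X : (uFormGroup (Fin 2) (Fin 1)).lie),
      ρK' k (φ' X) = φ' ((uFormGroup (Fin 2) (Fin 1)).Ad (Subgroup.inclusion (uFormGroup (Fin 2) (Fin 1)).maximalCompact_le_carrier k) X))
    (h𝔨' : ∀ W ∈ (uFormGroup (Fin 2) (Fin 1)).kInLie, ∀ X : (uFormGroup (Fin 2) (Fin 1)).lie, φ' ⁅W, X⁆ = ρ𝔤' W (φ' X))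
    (hwt' : ∀ X : (uFormGroup (Fin 2) (Fin 1)).lie, ρ𝔤' (upqZ0 (Fin 2) (Fin 1)) (φ' X) = ((δ : ℂ) * Complex.I) • φ' X)
    (hN' : ∀ (X : (uFormGroup (Fin 2) (Fin 1)).lie) (s : (Fin 2 × Fin 1) × Fin 2),
      ρ𝔤' (upqPBasis s) (φ' X) + ((δ : ℂ) * Complex.I) • ρ𝔤' ⁅upqZ0 (Fin 2) (Fin 1), upqPBasis s⁆ (φ' X) = 0) :
    AreGKEquivalent σK σ𝔤 σK' σ𝔤' := by
  obtain ⟨ψ, hψ, q0, qK, q𝔨, qwt, qN⟩ :=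
    exists_valueMap_irreducible_of_detected ρK ρ𝔤 σK σ𝔤 hdet φ hφ h0 hK h𝔨 hwt hN
  obtain ⟨ψ', hψ', r0, rK, r𝔨, rwt, rN⟩ :=
    exists_valueMap_irreducible_of_detected ρK' ρ𝔤' σK' σ𝔤' hdet' φ' hφ' h0' hK' h𝔨' hwt' hN'
  exact areGKEquivalent_of_valueMaps σK σ𝔤 hM σK' σ𝔤' hM' hirr hirr' hδ ψ ψ' q0 qK q𝔨 qwt qN r0 rK r𝔨 rwt rN hψ hψ'

omit hM hM' in
/-- **A non-zero value map on a DETECTED module yields a non-zero equivariant map to the detecting module** (datum (i) of the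
tensor-rigidity letter: `P.archModule → M` non-zero and `(𝔤, K)`-equivariant): detect one non-zero value `φ X₀`. [cite: Flath1979, Thm. 3] -/
theorem exists_ne_zero_map_of_valueMap
    (hdet : ∀ v : V, v ≠ 0 → ∃ T : V →ₗ[ℂ] M,
      (∀ (k : (uFormGroup (Fin 2) (Fin 1)).maximalCompact) (w : V), T (ρK k w) = σK k (T w)) ∧
      (∀ (X : (uFormGroup (Fin 2) (Fin 1)).lie) (w : V), T (ρ𝔤 X w) = σ𝔤 X (T w)) ∧ T v ≠ 0)
    (φ : (uFormGroup (Fin 2) (Fin 1)).lie →ₗ[ℝ] V) (hφ : φ ≠ 0) :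
    ∃ T : V →ₗ[ℂ] M,
      (∀ (k : (uFormGroup (Fin 2) (Fin 1)).maximalCompact) (w : V), T (ρK k w) = σK k (T w)) ∧
      (∀ (X : (uFormGroup (Fin 2) (Fin 1)).lie) (w : V), T (ρ𝔤 X w) = σ𝔤 X (T w)) ∧ T ≠ 0 := by
  obtain ⟨X₀, hX₀⟩ := exists_apply_ne_zero_of_ne_zero hφ
  obtain ⟨T, hTK, hT𝔤, hT⟩ := hdet _ hX₀
  exact ⟨T, hTK, hT𝔤, fun h => hT (by rw [h, LinearMap.zero_apply])⟩

end Detected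

end Summit.HodgeConjecture.HodgeConjecture.Cruxes.H413.F0P3ArchValueMapEquivalence

end
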